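import Literature.AlgebraicGeometry.Motives.TateConjectureStrongFormFrobeniusPolynomial
import Literature.AlgebraicGeometry.Motives.AbelianVarietyHopf
import HarnessLib

/-!
# `S^{2d}(X × X)` implies that Frobenius acts semisimply on `H^*(X)` (Milne 2007 Th. 1.3;
# Milne 1986 Rem. 8.6; Kahn 2020 Th. 6.54)

Topic `Literature/AlgebraicGeometry/Motives`; THEOREMS ONLY (no definition, no named fact).

J. S. Milne, *The Tate conjecture over finite fields (AIM talk)*, arXiv:0709.3040, Th. 1.3 (held,
p. 4): «Let `X` be a variety over `𝔽` of dimension `d`. If `S^{2d}(X × X, ℓ)` is true, then every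
Frobenius map `π` acts semisimply on `H^*(X, ℚ_ℓ)`. PROOF. If `a` occurs as an eigenvalue of `π` on
`H^r(X, ℚ_ℓ)`, then `1/a` occurs as an eigenvalue of `π` on `H^{2d-r}(X, ℚ_ℓ(d))` (by Poincaré
duality), and `H^r(X, ℚ_ℓ)_a ⊗ H^{2d-r}(X, ℚ_ℓ(d))_{1/a} ⊂ H^{2d}(X × X, ℚ_ℓ(d))_1` (Künneth formula),
from which the claim follows.» (Milne 1986 Rem. 8.6: «`T(X × X, ℓ, d)` implies `γ` acts semisimply on
the cohomology groups `H^i(X̄, ℚ_ℓ(r))`»; Kahn 2020 Th. 6.54 = Kahn 2004 th. 6: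
«`S^d(X × X, l) ⟺ SS^i(X, l)` for all `i`».)

This file proves Milne's Th. 1.3 with its printed proof for the tree's abstract Galois Weil
cohomology `E` over a finite field `k` — for the eigenvalues of Frobenius that lie in the
coefficient field `K` (the printed argument works with an eigenvalue `a` and an eigenvector for
`1/a`; for `a ∉ K` it is applied after extending scalars, which is not done here):

* §1 (any field) **the external product is Galois equivariant with a twist on the second
  factor** — `χ(g)^t g(pr₁*a ∪ pr₂*b) = pr₁*(g a) ∪ pr₂*(χ(g)^t g b)` (`ρTwist_externalCup_right`;
  the untwisted case is the tree's `WeilDeligneKunneth.ρ_externalCup`, kept private here to avoid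
  its module's import closure); the Poincaré pairing `Hⁱ(X) × H^{2d-i}(X)(d) → K` is invariant
  (`cupPairing_ρ_ρTwist`); the external product of non-zero classes is non-zero
  (`externalCup_ne_zero`, via the tree's `kunnethComponent_externalCup_self`; compare
  `WeilDeligneKunneth.injective_lift_externalCup`);
* §2 (pure linear algebra, namespace `Literature.LinearAlgebra.InvariantPairing`) **the eigenvalue
  `μ⁻¹` of `ψ` has the same geometric multiplicity as the eigenvalue `μ` of `φ`** for a perfect pairing
  invariant under `(φ, ψ)` (`finrank_ker_sub_smul_inv_eq`: «`1/a` occurs as an eigenvalue … by Poincaré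
  duality»; from `finrank_ker_sub_one_eq` of row g37-#1 applied to `(μ⁻¹ φ, μ ψ)`);
* §3 (`k` finite) **MILNE 2007 TH. 1.3**: if `1` is a semisimple eigenvalue of the twisted Frobenius
  `χ(F)^d F` on `H^{2d}(X × X)` (`S^{2d}(X × X)`: `Ker ∩ Range = 0`), then for every `i` and every
  `μ ∈ K` the generalized eigenspace of `F` on `Hⁱ(X)` for `μ` is the eigenspace
  (`maxGenEigenspace_frobAction_eq_eigenspace`: «`π` acts semisimply on `H_a`»; twisted form
  `maxGenEigenspace_ρTwist_geomFrob_eq_eigenspace` via `eigenspace_smul_eq`); in particular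
  `S(r)` holds for `X` in every codimension `r` (`ker_inf_range_eq_bot_of_self_product`).
  -- TODO(general form): eigenvalues outside `K` (semisimplicity of `F` as an endomorphism, Kahn's
  -- `SS^i`, follows for those `i` whose characteristic polynomial splits over `K`).

## Provenance

Lane `lit-hodgefound` (summit `HodgeConjecture`, Track 2 foundations library, Layer B: motives),
seat `lit-hodgefound-p29` (literature-prover, generation 37, row g37-#7).
-/

universe u v

open CategoryTheory AlgebraicGeometry MonoidalCategory CartesianMonoidalCategory
open scoped TensorProduct

noncomputable section

/-! ## §2 (pure) The eigenvalue `μ⁻¹` of `ψ` versus the eigenvalue `μ` of `φ` -/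

namespace Literature.LinearAlgebra.InvariantPairing

variable {K : Type*} [Field K]
variable {V : Type*} [AddCommGroup V] [Module K V] [FiniteDimensional K V]
variable {W : Type*} [AddCommGroup W] [Module K W] [FiniteDimensional K W]

omit [FiniteDimensional K W] in
/-- **`dim Ker(ψ - μ⁻¹) = dim Ker(φ - μ)`** for a perfect pairing `B` with `B(φ v, ψ w) = B(v, w)`
and `μ ≠ 0`: the pair `(μ⁻¹ φ, μ ψ)` leaves `B` invariant too, and its fixed spaces are these
eigenspaces («if `a` occurs as an eigenvalue of `π` on `H^r`, then `1/a` occurs as an eigenvalue of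
`π` on `H^{2d-r}(d)` (by Poincaré duality)»). [cite: Milne2007TateFiniteFieldsAIM, Th. 1.3 (proof)] -/
theorem finrank_ker_sub_smul_inv_eq (B : V →ₗ[K] W →ₗ[K] K) [B.IsPerfPair] {φ : Module.End K V}
    {ψ : Module.End K W} (h : ∀ v w, B (φ v) (ψ w) = B v w) {μ : K} (hμ : μ ≠ 0) :
    Module.finrank K (LinearMap.ker (ψ - μ⁻¹ • 1)) =
      Module.finrank K (LinearMap.ker (φ - μ • 1)) := by
  have h' : ∀ v w, B ((μ⁻¹ • φ) v) ((μ • ψ) w) = B v w := fun v w ↦ by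
    simp only [LinearMap.smul_apply, map_smul]
    rw [h v w, smul_smul, mul_inv_cancel₀ hμ, one_smul]
  have hφ : LinearMap.ker (μ⁻¹ • φ - 1) = LinearMap.ker (φ - μ • 1) := by
    ext v
    simp only [LinearMap.mem_ker, LinearMap.sub_apply, LinearMap.smul_apply, Module.End.one_apply,
      sub_eq_zero]
    constructor
    · intro hv
      have := congrArg (μ • ·) hv
      simpa only [smul_smul, mul_inv_cancel₀ hμ, one_smul] using this
    · intro hv
      rw [hv, smul_smul, inv_mul_cancel₀ hμ, one_smul]
  have hψ : LinearMap.ker (μ • ψ - 1) = LinearMap.ker (ψ - μ⁻¹ • 1) := by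
    ext w
    simp only [LinearMap.mem_ker, LinearMap.sub_apply, LinearMap.smul_apply, Module.End.one_apply,
      sub_eq_zero]
    constructor
    · intro hw
      have := congrArg (μ⁻¹ • ·) hw
      simpa only [smul_smul, inv_mul_cancel₀ hμ, one_smul] using this
    · intro hw
      rw [hw, smul_smul, mul_inv_cancel₀ hμ, one_smul]
  rw [← hψ, ← hφ]
  exact finrank_ker_sub_one_eq B h'

end Literature.LinearAlgebra.InvariantPairing

namespace Literature.AlgebraicGeometry.Motives

open Literature.LinearAlgebra

/-- **`Eig(a f, a μ) = Eig(f, μ)`** for a scalar `a ≠ 0` (companion of the tree's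
`maxGenEigenspace_smul_eq`): applied to the twisted Frobenius `χ(F)^t F = c^t • F`, the eigenspace of
`χ(F)^t F` for `μ` is the eigenspace of `F` for `c^{-t} μ` («`H^{2d-r}(X, ℚ_ℓ(d))_{1/a}`»).
[cite: Milne2007TateFiniteFieldsAIM, §1 Th. 1.3 (proof: the eigenspaces of the twisted Frobenius)] -/
theorem eigenspace_smul_eq {K : Type*} [Field K] {V : Type*} [AddCommGroup V] [Module K V]
    (f : Module.End K V) {a : K} (ha : a ≠ 0) (μ : K) :
    Module.End.eigenspace (a • f) (a * μ) = Module.End.eigenspace f μ := by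
  ext x
  simp only [Module.End.mem_eigenspace_iff, LinearMap.smul_apply, mul_smul]
  constructor
  · intro hx
    have := congrArg (a⁻¹ • ·) hx
    simpa only [smul_smul, inv_mul_cancel₀ ha, inv_mul_cancel_left₀ ha, one_smul] using this
  · intro hx
    rw [hx]

/-! ## §1 Equivariance of the external product; non-vanishing -/

namespace WeilCohomology

variable {k : Type u} [Field k] {K : Type v} [Field K] [CharZero K] (W : WeilCohomology k K)
variable {n m : ℕ} {X Y : SchemeOver k}

omit [CharZero K] in
/-- Over a field, the elementary tensor of two non-zero vectors is non-zero. [folklore] -/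
private theorem tmul_ne_zero_aux {V₁ V₂ : Type*} [AddCommGroup V₁] [Module K V₁] [AddCommGroup V₂]
    [Module K V₂] {v : V₁} {w : V₂} (hv : v ≠ 0) (hw : w ≠ 0) : v ⊗ₜ[K] w ≠ 0 := by
  obtain ⟨φ, hφ⟩ := Module.Projective.exists_dual_ne_zero K hv
  obtain ⟨ψ, hψ⟩ := Module.Projective.exists_dual_ne_zero K hw
  intro h
  have h' : TensorProduct.lift ((LinearMap.mul K K).compl₁₂ φ ψ) (v ⊗ₜ[K] w) = φ v * ψ w := by
    rw [TensorProduct.lift.tmul]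
    rfl
  rw [h, map_zero] at h'
  exact mul_ne_zero hφ hψ h'.symm

/-- **`pr₁* a ∪ pr₂* b ≠ 0` for `a ≠ 0`, `b ≠ 0`** on `X × Y` (both smooth projective): its Künneth
component in bidegree `(i, j)` is `a ⊗ b ≠ 0` (the tree's `kunnethComponent_externalCup_self`,
axiom (B)). [cite: Kleiman1968AlgebraicCycles, §1.2 (B)] -/
theorem externalCup_ne_zero (hX : IsSmoothProjective n X) (hY : IsSmoothProjective m Y)
    {i j e : ℕ} (h : i + j = e) {a : W.obj X i} {b : W.obj Y j} (ha : a ≠ 0) (hb : b ≠ 0) :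
    W.externalCup X Y h a b ≠ 0 := by
  intro h0
  have := W.kunnethComponent_externalCup_self hX hY h a b
  rw [h0, map_zero] at this
  exact tmul_ne_zero_aux (K := K) ha hb this.symm

end WeilCohomology

namespace GaloisWeilCohomology

variable {k : Type u} [Field k] {K : Type v} [Field K] [CharZero K]
  {χ : Field.absoluteGaloisGroup k →* Kˣ} (E : GaloisWeilCohomology k K χ)
variable {n m d : ℕ} {X Y : SchemeOver k}

/-- The external product is Galois equivariant: `g (pr₁* a ∪ pr₂* b) = pr₁* (g a) ∪ pr₂* (g b)`
on `X × Y` (axioms `cup_ρ` on `X × Y` and `pullback_ρ` for the two projections). This is the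
tree's public `Literature.NumberTheory.LFunctions.WeilDeligneKunneth.ρ_externalCup`
(`NumberTheory/LFunctions/WeilConjecturesDeligneKunnethProofs`), copied here as a private helper so
that this `Motives` file does not import the Dwork–Fatou–Segre closure of that module; the public
twisted form is `ρTwist_externalCup_right` below. [folklore] -/
private theorem ρ_externalCup_aux (hX : IsSmoothProjective n X) (hY : IsSmoothProjective m Y)
    {i j e : ℕ}
    (h : i + j = e) (g : Field.absoluteGaloisGroup k) (a : E.obj X i) (b : E.obj Y j) :
    E.ρ (X ⊗ Y) e g (E.externalCup X Y h a b) =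
      E.externalCup X Y h (E.ρ X i g a) (E.ρ Y j g b) := by
  have hXY := IsSmoothProjective.tensor_holds hX hY
  have h1 : E.ρ (X ⊗ Y) i g (E.pullback (fst X Y) i a) = E.pullback (fst X Y) i (E.ρ X i g a) := by
    simpa only [LinearMap.comp_apply] using congr($(E.pullback_ρ hXY hX (fst X Y) i g) a)
  have h2 : E.ρ (X ⊗ Y) j g (E.pullback (snd X Y) j b) = E.pullback (snd X Y) j (E.ρ Y j g b) := by
    simpa only [LinearMap.comp_apply] using congr($(E.pullback_ρ hXY hY (snd X Y) j g) b)
  rw [E.externalCup_apply, E.externalCup_apply, E.cup_ρ hXY h g, h1, h2]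

/-- **The external product is Galois equivariant, with a twist on the second factor**:
`χ(g)^t g (pr₁* a ∪ pr₂* b) = pr₁* (g a) ∪ pr₂* (χ(g)^t g b)` on `X × Y` (for `t = 0` this is
`WeilDeligneKunneth.ρ_externalCup`). [cite: Tate1994, §1]
[cite: Milne2007TateFiniteFieldsAIM, Th. 1.3 (proof)] -/
theorem ρTwist_externalCup_right (hX : IsSmoothProjective n X) (hY : IsSmoothProjective m Y)
    {i j e : ℕ} (h : i + j = e) (t : ℤ) (g : Field.absoluteGaloisGroup k) (a : E.obj X i)
    (b : E.obj Y j) :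
    E.ρTwist (X ⊗ Y) e t g (E.externalCup X Y h a b) =
      E.externalCup X Y h (E.ρ X i g a) (E.ρTwist Y j t g b) := by
  rw [ρTwist_apply, ρTwist_apply, E.ρ_externalCup_aux hX hY h g a b, map_smul]

/-- **The Poincaré pairing `Hⁱ(X) × Hʲ(X)(d) → K` (`i + j = 2d`) is invariant**:
`tr(g a ∪ χ(g)^d g b) = tr(a ∪ b)`. [cite: Tate1994, §1] [cite: Milne2007TateFiniteFieldsAIM, Th. 1.3 (proof)] -/
theorem cupPairing_ρ_ρTwist (hX : IsSmoothProjective d X) {i j : ℕ} (h : i + j = 2 * d)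
    (g : Field.absoluteGaloisGroup k) (a : E.obj X i) (b : E.obj X j) :
    E.cupPairing X d i j h (E.ρ X i g a) (E.ρTwist X j d g b) = E.cupPairing X d i j h a b := by
  rw [E.cupPairing_apply, E.cupPairing_apply, ρTwist_apply, map_smul, ← E.cup_ρ hX h g a b]
  exact E.trace_ρ hX g _

variable [Finite k]

/-! ## §3 Milne 2007 Th. 1.3 -/

/-- **Milne 2007 Th. 1.3 — `S^{2d}(X × X)` ⟹ Frobenius acts semisimply on every `Hⁱ(X)_μ`**: if `1`
is a semisimple eigenvalue of the twisted Frobenius `χ(F)^d F` on `H^{2d}(X × X)` (`Ker ∩ Range = 0`),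
then for every `i` and every `μ ∈ K` the generalized eigenspace of `F` on `Hⁱ(X)` for `μ` is the
eigenspace. Printed proof: for `(F-μ)²v = 0`, `u = (F-μ)v ≠ 0`, pick `w ≠ 0` with
`χ(F)^d F w = μ⁻¹ w` on `H^{2d-i}(X)` (Poincaré duality, `finrank_ker_sub_smul_inv_eq`); then
`y = pr₁*u ∪ pr₂*w ≠ 0` (Künneth) is fixed by `χ(F)^d F` on `H^{2d}(X × X)` and equals
`μ (χ(F)^d F - 1)(pr₁*v ∪ pr₂*w)`, contradicting `S`. [cite: Milne2007TateFiniteFieldsAIM, Th. 1.3]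
[cite: Milne1986ValuesZetaFunctionsFiniteFields, §8 Rem. 8.6] [cite: Kahn2020, §6.14 Th. 6.54] -/
theorem maxGenEigenspace_frobAction_eq_eigenspace (hX : IsSmoothProjective d X)
    (hS : LinearMap.ker (E.ρTwist (X ⊗ X) (2 * d) d (geomFrob k) - 1) ⊓
      LinearMap.range (E.ρTwist (X ⊗ X) (2 * d) d (geomFrob k) - 1) = ⊥)
    {i : ℕ} (hi : i ≤ 2 * d) (μ : K) :
    Module.End.maxGenEigenspace (E.frobAction X i) μ = Module.End.eigenspace (E.frobAction X i) μ := by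
  haveI := E.finite_obj hX i
  have hj : i + (2 * d - i) = 2 * d := by omega
  haveI := E.finite_obj hX (2 * d - i)
  haveI := E.isPerfPair_cupPairing hX i (2 * d - i) hj
  set F := E.frobAction X i with hF
  set ψ := E.ρTwist X (2 * d - i) d (geomFrob k) with hψ
  set Φ := E.ρTwist (X ⊗ X) (2 * d) d (geomFrob k) with hΦ
  rw [InvariantPairing.maxGenEigenspace_eq_eigenspace_iff]
  refine le_antisymm (fun v hv ↦ ?_) (fun v hv ↦ ?_)
  swap
  · rw [LinearMap.mem_ker] at hv ⊢
    rw [pow_two, Module.End.mul_apply, hv, map_zero]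
  rw [LinearMap.mem_ker] at hv ⊢
  by_contra hu
  set u := (F - μ • 1) v with hu_def
  -- `u` is an eigenvector for `μ`
  have hFu : F u = μ • u := by
    have : (F - μ • 1) u = 0 := by rw [hu_def, ← Module.End.mul_apply, ← pow_two, hv]
    simpa [sub_eq_zero] using this
  -- `F` is injective, so `μ ≠ 0`
  have hμ : μ ≠ 0 := by
    rintro rfl
    rw [zero_smul] at hFu
    have hinj : Function.Injective F := by
      intro a b hab
      have := congrArg (E.ρ X i (geomFrob k)⁻¹) hab
      rwa [hF, frobAction_def, ← Module.End.mul_apply, ← map_mul, inv_mul_cancel, map_one,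
        Module.End.one_apply, ← Module.End.mul_apply, ← map_mul, inv_mul_cancel, map_one,
        Module.End.one_apply] at this
    exact hu (hinj (by rw [hFu, map_zero]))
  -- an eigenvector `w ≠ 0` of `ψ = χ(F)^d F` on `H^{2d-i}(X)` for `μ⁻¹`
  have hinv : ∀ a b, E.cupPairing X d i (2 * d - i) hj (F a) (ψ b) =
      E.cupPairing X d i (2 * d - i) hj a b := fun a b ↦ by
    rw [hF, frobAction_def]
    exact E.cupPairing_ρ_ρTwist hX hj (geomFrob k) a b
  have hdim := InvariantPairing.finrank_ker_sub_smul_inv_eq (E.cupPairing X d i (2 * d - i) hj) hinv hμ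
  have hker_ne : LinearMap.ker (ψ - μ⁻¹ • 1) ≠ ⊥ := by
    intro hbot
    have h0 : Module.finrank K (LinearMap.ker (F - μ • 1)) = 0 := by
      rw [← hdim, hbot, finrank_bot]
    rw [Submodule.finrank_eq_zero] at h0
    have : u ∈ LinearMap.ker (F - μ • 1) := by
      rw [LinearMap.mem_ker, LinearMap.sub_apply, LinearMap.smul_apply, Module.End.one_apply, hFu,
        sub_self]
    rw [h0, Submodule.mem_bot] at this
    exact hu this
  obtain ⟨w, hw, hw0⟩ := (Submodule.ne_bot_iff _).mp hker_ne
  have hψw : ψ w = μ⁻¹ • w := by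
    simpa [LinearMap.mem_ker, sub_eq_zero] using hw
  -- the classes `x = pr₁*v ∪ pr₂*w` and `y = pr₁*u ∪ pr₂*w` on `X × X`
  have hy0 : E.externalCup X X hj u w ≠ 0 := E.externalCup_ne_zero hX hX hj hu hw0
  have hΦy : Φ (E.externalCup X X hj u w) = E.externalCup X X hj u w := by
    rw [hΦ, E.ρTwist_externalCup_right hX hX hj d (geomFrob k) u w, ← frobAction_def, ← hF, ← hψ,
      hFu, hψw, map_smul, map_smul, LinearMap.smul_apply, smul_smul, inv_mul_cancel₀ hμ, one_smul]
  have hΦx : (Φ - 1) (E.externalCup X X hj v w) = μ⁻¹ • E.externalCup X X hj u w := by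
    rw [LinearMap.sub_apply, Module.End.one_apply, hΦ,
      E.ρTwist_externalCup_right hX hX hj d (geomFrob k) v w, ← frobAction_def, ← hF, ← hψ, hψw,
      map_smul, hu_def, LinearMap.sub_apply, LinearMap.smul_apply, Module.End.one_apply, map_sub,
      LinearMap.sub_apply, map_smul, LinearMap.smul_apply, smul_sub, smul_smul, inv_mul_cancel₀ hμ,
      one_smul]
  have hmem : E.externalCup X X hj u w ∈ LinearMap.ker (Φ - 1) ⊓ LinearMap.range (Φ - 1) := by
    refine Submodule.mem_inf.mpr ⟨?_, ?_⟩
    · rw [LinearMap.mem_ker, LinearMap.sub_apply, Module.End.one_apply, hΦy, sub_self]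
    · refine LinearMap.mem_range.mpr ⟨μ • E.externalCup X X hj v w, ?_⟩
      rw [map_smul, hΦx, smul_smul, mul_inv_cancel₀ hμ, one_smul]
  rw [hS, Submodule.mem_bot] at hmem
  exact hy0 hmem

/-- **Twisted form of Th. 1.3**: under `S^{2d}(X × X)`, for every `i`, every twist `t` and every
`μ ∈ K` the generalized eigenspace of the twisted Frobenius `χ(F)^t F` on `Hⁱ(X)` for `μ` is the
eigenspace (`χ(F)^t F = c^t • F` with `c = χ(F) ≠ 0`). [cite: Milne2007TateFiniteFieldsAIM, Th. 1.3]
[cite: Milne1986ValuesZetaFunctionsFiniteFields, §8 Rem. 8.6] -/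
theorem maxGenEigenspace_ρTwist_geomFrob_eq_eigenspace (hX : IsSmoothProjective d X)
    (hS : LinearMap.ker (E.ρTwist (X ⊗ X) (2 * d) d (geomFrob k) - 1) ⊓
      LinearMap.range (E.ρTwist (X ⊗ X) (2 * d) d (geomFrob k) - 1) = ⊥)
    {i : ℕ} (hi : i ≤ 2 * d) (t : ℕ) (μ : K) :
    Module.End.maxGenEigenspace (E.ρTwist X i t (geomFrob k)) μ =
      Module.End.eigenspace (E.ρTwist X i t (geomFrob k)) μ := by
  set c : K := ((χ (geomFrob k) : Kˣ) : K) with hc_def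
  have hct : c ^ t ≠ 0 := pow_ne_zero t (χ (geomFrob k)).ne_zero
  obtain ⟨ν, rfl⟩ : ∃ ν, μ = c ^ t * ν :=
    ⟨(c ^ t)⁻¹ * μ, by rw [← mul_assoc, mul_inv_cancel₀ hct, one_mul]⟩
  rw [E.ρTwist_geomFrob_natCast X i t, ← hc_def, maxGenEigenspace_smul_eq (E.frobAction X i) hct,
    eigenspace_smul_eq (E.frobAction X i) hct, E.maxGenEigenspace_frobAction_eq_eigenspace hX hS hi]

/-- **`S^{2d}(X × X)` ⟹ `S(r)` for `X` in every codimension `r`**: `1` is then a semisimple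
eigenvalue of the twisted Frobenius `χ(F)^r F` on `H^{2r}(X)` (the generalized eigenspace of `F` for
`χ(F)^{-r}` is the eigenspace). [cite: Milne2007TateFiniteFieldsAIM, Th. 1.3]
[cite: Kahn2020, §6.14 Th. 6.54] -/
theorem ker_inf_range_eq_bot_of_self_product (hX : IsSmoothProjective d X)
    (hS : LinearMap.ker (E.ρTwist (X ⊗ X) (2 * d) d (geomFrob k) - 1) ⊓
      LinearMap.range (E.ρTwist (X ⊗ X) (2 * d) d (geomFrob k) - 1) = ⊥)
    {r : ℕ} (hr : r ≤ d) :
    LinearMap.ker (E.ρTwist X (2 * r) r (geomFrob k) - 1) ⊓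
      LinearMap.range (E.ρTwist X (2 * r) r (geomFrob k) - 1) = ⊥ := by
  set c : K := ((χ (geomFrob k) : Kˣ) : K) with hc_def
  have hc : c ≠ 0 := (χ (geomFrob k)).ne_zero
  have hcr : c ^ r ≠ 0 := pow_ne_zero r hc
  have hsemi := E.maxGenEigenspace_frobAction_eq_eigenspace hX hS (by omega : 2 * r ≤ 2 * d) (c ^ r)⁻¹
  rw [InvariantPairing.ker_inf_range_eq_bot_iff_maxGenEigenspace_eq,
    E.ρTwist_geomFrob_natCast X (2 * r) r, ← hc_def]
  -- generalized eigenspace and eigenspace of `c^r • F` for `1 = c^r · (c^r)⁻¹`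
  have h1 : Module.End.maxGenEigenspace ((c ^ r) • E.frobAction X (2 * r)) 1 =
      Module.End.maxGenEigenspace (E.frobAction X (2 * r)) (c ^ r)⁻¹ := by
    rw [← maxGenEigenspace_smul_eq (E.frobAction X (2 * r)) hcr (c ^ r)⁻¹, mul_inv_cancel₀ hcr]
  rw [h1, hsemi, Module.End.eigenspace_def]
  ext x
  simp only [LinearMap.mem_ker, LinearMap.sub_apply, LinearMap.smul_apply, Module.End.one_apply,
    sub_eq_zero]
  constructor
  · intro hx
    rw [hx, smul_smul, mul_inv_cancel₀ hcr, one_smul]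
  · intro hx
    have := congrArg ((c ^ r)⁻¹ • ·) hx
    simpa only [smul_smul, inv_mul_cancel₀ hcr, one_smul] using this

end GaloisWeilCohomology

end Literature.AlgebraicGeometry.Motives

end
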